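import Summits.Ventures.PercRepro.S1CoreCapSpecFiveHeavy

/-!
# PercRepro — TOWARDS `Q*(5) = 11`: CONFIGURATIONS WITH TWO 4-POINT LINES (p1, gen 24)

At nullity `5`, with every line of weight `≤ 4`: three 4-point lines are impossible (`not_three_four`: the ordering
costs `2 + 2 + 2`). With two 4-point lines `L₁, L₂` (simple, cap `4 + 4`) every other line is a simple 3-point line
(`shape_of_two_four`), any two of them cover each other over `L₁ ∪ L₂` (`subset_of_two_four`), so each further
line has exactly one point on `L₁`, off `L₂` (`meet_four_of_two_four`), distinct further lines have distinct such
points (`ne_of_mem_four`), and two further lines force `L₁ ∩ L₂ ≠ ∅` (`not_disjoint_of_two_four`: the ordering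
`X, L₁, Y, L₂` costs `1 + 2 + 1 + 2`). Hence at most `3` further lines and cap sum `≤ 4 + 4 + 3 = 11`
(`sum_cap_le_eleven_of_two_four`) — the extremal configuration of the searches. `proofs/P1-S4-CAPBRIDGE.md` §16.
Axioms: standard.
-/

namespace PercRepro

namespace S1

namespace FourCap

variable {β : Type} [DecidableEq β]

/-- `fat` is subadditive over unions. -/
theorem fat_union_le (w : β → ℕ) (S T : Finset β) : fat w (S ∪ T) ≤ fat w S + fat w T := by
  unfold fat
  rw [Finset.filter_union]
  exact Finset.card_union_le _ _

omit [DecidableEq β] in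
/-- A point of a line without fat points has weight `1`. -/
theorem weight_one_of_fat_zero {w : β → ℕ} {L : Finset β} (hw : ∀ v ∈ L, w v = 1 ∨ w v = 2)
    (hf : fat w L = 0) {v : β} (hv : v ∈ L) : w v = 1 := by
  rcases hw v hv with h | h
  · exact h
  · exfalso
    have : 0 < fat w L := by
      unfold fat
      exact Finset.card_pos.2 ⟨v, Finset.mem_filter.2 ⟨hv, h⟩⟩
    omega

omit [DecidableEq β] in
/-- A 4-point line of weight `≤ 4` is simple: no fat point, weight exactly `4`. -/
theorem simple_of_card_four {w : β → ℕ} {L : Finset β} (hw : ∀ v ∈ L, w v = 1 ∨ w v = 2) (hw4 : wsum w L ≤ 4)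
    (hc : L.card = 4) : fat w L = 0 ∧ wsum w L = 4 := by
  have := wsum_eq_card_add_fat w L hw
  omega

omit [DecidableEq β] in
/-- A line of weight `≤ 4` with `≥ 3` points has `3` or `4` points; a 3-point line has at most one fat point. -/
theorem card_three_or_four {w : β → ℕ} {L : Finset β} (hw : ∀ v ∈ L, w v = 1 ∨ w v = 2) (hw4 : wsum w L ≤ 4)
    (hk : 3 ≤ L.card) : (L.card = 3 ∧ fat w L ≤ 1) ∨ (L.card = 4 ∧ fat w L = 0) := by
  have := wsum_eq_card_add_fat w L hw
  omega

section FiveFour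

variable {w : β → ℕ} {ls : Finset (Finset β)}
  (h1 : ∀ L ∈ ls, ∀ v ∈ L, w v = 1 ∨ w v = 2)
  (h2 : ∀ L ∈ ls, 3 ≤ L.card ∧ wsum w L ≤ 5)
  (h3 : ∀ L ∈ ls, ∀ L' ∈ ls, L ≠ L' → (L ∩ L').card ≤ 1)
  (h4 : ∀ l : List (Finset β), l.Nodup → (∀ L ∈ l, L ∈ ls) → wsum w (unionL l) ≤ 5 + lineRank l)
  (hw4 : ∀ L ∈ ls, wsum w L ≤ 4)

include h1 h3 h4 hw4 in
/-- **Three 4-point lines are impossible** at nullity `5` with weights `≤ 4`: the ordering costs `2 + 2 + 2`. -/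
theorem not_three_four {L₁ L₂ L₃ : Finset β} (hL₁ : L₁ ∈ ls) (hL₂ : L₂ ∈ ls) (hL₃ : L₃ ∈ ls)
    (h21 : L₂ ≠ L₁) (h31 : L₃ ≠ L₁) (h32 : L₃ ≠ L₂) (c1 : L₁.card = 4) (c2 : L₂.card = 4) (c3 : L₃.card = 4) :
    False := by
  have hw : ∀ L ∈ ls, ∀ v ∈ L, 1 ≤ w v := fun L hL v hv => by rcases h1 L hL v hv with h | h <;> omega
  have hc := h4 [L₃, L₂, L₁] (by simp [h21, h31, h32]) (by simp [hL₁, hL₂, hL₃])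
  obtain ⟨a1, b1, c1', d1⟩ := cost_step w L₁ [] (hw L₁ hL₁)
  obtain ⟨a2, b2, c2', d2⟩ := cost_step w L₂ [L₁] (hw L₂ hL₂)
  obtain ⟨a3, b3, c3', d3⟩ := cost_step w L₃ [L₂, L₁] (hw L₃ hL₃)
  obtain ⟨e0, e1, e2, e3⟩ := cost_start w L₁
  have i2 : (L₂ ∩ unionL [L₁]).card ≤ 1 := by
    simp only [unionL, Finset.union_empty]
    exact h3 L₂ hL₂ L₁ hL₁ h21
  have i3 : (L₃ ∩ unionL [L₂, L₁]).card ≤ 2 := by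
    simp only [unionL, Finset.union_empty]
    rw [Finset.inter_union_distrib_left]
    refine (Finset.card_union_le _ _).trans ?_
    have := h3 L₃ hL₃ L₂ hL₂ h32
    have := h3 L₃ hL₃ L₁ hL₁ h31
    omega
  have w1 := (simple_of_card_four (h1 L₁ hL₁) (hw4 L₁ hL₁) c1).2
  omega

include h1 h2 h3 h4 hw4 in
/-- **With two 4-point lines every other line is a simple 3-point line**: after `L₁, L₂` (cost `2 + 2`) the line
costs `|X| − 2 + fat (X ∖ (L₁ ∪ L₂)) ≤ 1`, and the points of `L₁ ∪ L₂` are simple. -/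
theorem shape_of_two_four {L₁ L₂ X : Finset β} (hL₁ : L₁ ∈ ls) (hL₂ : L₂ ∈ ls) (hX : X ∈ ls)
    (h21 : L₂ ≠ L₁) (hX1 : X ≠ L₁) (hX2 : X ≠ L₂) (c1 : L₁.card = 4) (c2 : L₂.card = 4) :
    X.card = 3 ∧ fat w X = 0 := by
  have hw : ∀ L ∈ ls, ∀ v ∈ L, 1 ≤ w v := fun L hL v hv => by rcases h1 L hL v hv with h | h <;> omega
  have hc := h4 [X, L₂, L₁] (by simp [h21, hX1, hX2]) (by simp [hL₁, hL₂, hX])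
  obtain ⟨a1, b1, c1', d1⟩ := cost_step w L₁ [] (hw L₁ hL₁)
  obtain ⟨a2, b2, c2', d2⟩ := cost_step w L₂ [L₁] (hw L₂ hL₂)
  obtain ⟨a3, b3, c3', d3⟩ := cost_step w X [L₂, L₁] (hw X hX)
  obtain ⟨e0, e1, e2, e3⟩ := cost_start w L₁
  have i2 : (L₂ ∩ unionL [L₁]).card ≤ 1 := by
    simp only [unionL, Finset.union_empty]
    exact h3 L₂ hL₂ L₁ hL₁ h21
  have i3 : (X ∩ unionL [L₂, L₁]).card ≤ 2 := by
    simp only [unionL, Finset.union_empty]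
    rw [Finset.inter_union_distrib_left]
    refine (Finset.card_union_le _ _).trans ?_
    have := h3 X hX L₂ hL₂ hX2
    have := h3 X hX L₁ hL₁ hX1
    omega
  have w1 := (simple_of_card_four (h1 L₁ hL₁) (hw4 L₁ hL₁) c1).2
  have f3 := wsum_sdiff_eq w X (unionL [L₂, L₁]) (h1 X hX)
  have kX := (h2 X hX).1
  have hcard : X.card = 3 := by omega
  have hfat0 : fat w (X \ unionL [L₂, L₁]) = 0 := by omega
  refine ⟨hcard, ?_⟩
  have hsplit := fat_sdiff_add_fat_inter w X (unionL [L₂, L₁])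
  have hU : fat w (X ∩ unionL [L₂, L₁]) = 0 := by
    have hmono := fat_mono w (Finset.inter_subset_right (s₁ := X) (s₂ := unionL [L₂, L₁]))
    have hU' : fat w (unionL [L₂, L₁]) = 0 := by
      simp only [unionL, Finset.union_empty]
      have := fat_union_le w L₂ L₁
      have := (simple_of_card_four (h1 L₁ hL₁) (hw4 L₁ hL₁) c1).1
      have := (simple_of_card_four (h1 L₂ hL₂) (hw4 L₂ hL₂) c2).1
      omega
    omega
  omega

include h1 h2 h3 h4 hw4 in
/-- **Two further lines cover each other over two 4-point lines**: after `L₁, L₂, X` (cost `2 + 2 + 1`) a fourth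
line `Y` costs `0`, i.e. `Y ⊆ L₁ ∪ L₂ ∪ X`. -/
theorem subset_of_two_four {L₁ L₂ X Y : Finset β} (hL₁ : L₁ ∈ ls) (hL₂ : L₂ ∈ ls) (hX : X ∈ ls) (hY : Y ∈ ls)
    (h21 : L₂ ≠ L₁) (hX1 : X ≠ L₁) (hX2 : X ≠ L₂) (hY1 : Y ≠ L₁) (hY2 : Y ≠ L₂) (hYX : Y ≠ X)
    (c1 : L₁.card = 4) (c2 : L₂.card = 4) : ∀ v ∈ Y, v ∈ X ∨ v ∈ L₂ ∨ v ∈ L₁ := by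
  have hw : ∀ L ∈ ls, ∀ v ∈ L, 1 ≤ w v := fun L hL v hv => by rcases h1 L hL v hv with h | h <;> omega
  have hc := h4 [Y, X, L₂, L₁] (by simp [h21, hX1, hX2, hY1, hY2, hYX]) (by simp [hL₁, hL₂, hX, hY])
  obtain ⟨a1, b1, c1', d1⟩ := cost_step w L₁ [] (hw L₁ hL₁)
  obtain ⟨a2, b2, c2', d2⟩ := cost_step w L₂ [L₁] (hw L₂ hL₂)
  obtain ⟨a3, b3, c3', d3⟩ := cost_step w X [L₂, L₁] (hw X hX)
  obtain ⟨a4, b4, c4', d4⟩ := cost_step w Y [X, L₂, L₁] (hw Y hY)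
  obtain ⟨e0, e1, e2, e3⟩ := cost_start w L₁
  have i2 : (L₂ ∩ unionL [L₁]).card ≤ 1 := by
    simp only [unionL, Finset.union_empty]
    exact h3 L₂ hL₂ L₁ hL₁ h21
  have i3 : (X ∩ unionL [L₂, L₁]).card ≤ 2 := by
    simp only [unionL, Finset.union_empty]
    rw [Finset.inter_union_distrib_left]
    refine (Finset.card_union_le _ _).trans ?_
    have := h3 X hX L₂ hL₂ hX2
    have := h3 X hX L₁ hL₁ hX1
    omega
  have w1 := (simple_of_card_four (h1 L₁ hL₁) (hw4 L₁ hL₁) c1).2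
  have f3 := wsum_sdiff_eq w X (unionL [L₂, L₁]) (h1 X hX)
  obtain ⟨kX, fX⟩ := shape_of_two_four h1 h2 h3 h4 hw4 hL₁ hL₂ hX h21 hX1 hX2 c1 c2
  have fX' : fat w (X \ unionL [L₂, L₁]) = 0 := by
    have := fat_mono w (Finset.sdiff_subset (s := X) (t := unionL [L₂, L₁]))
    omega
  have kY := (h2 Y hY).1
  have hzero : (Y \ unionL [X, L₂, L₁]).card = 0 := by omega
  have hsub : Y ⊆ unionL [X, L₂, L₁] := Finset.sdiff_eq_empty_iff_subset.1 (Finset.card_eq_zero.1 hzero)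
  intro v hv
  have h := hsub hv
  rw [mem_unionL_iff] at h
  simpa using h

include h3 in
/-- A line other than `L₁, L₂` has a point off `L₁ ∪ L₂` (it meets each in `≤ 1` point). -/
theorem exists_off_two {L₁ L₂ X : Finset β} (hL₁ : L₁ ∈ ls) (hL₂ : L₂ ∈ ls) (hX : X ∈ ls)
    (hX1 : X ≠ L₁) (hX2 : X ≠ L₂) (kX : X.card = 3) : ∃ t ∈ X, t ∉ L₁ ∧ t ∉ L₂ := by
  by_contra hno
  push Not at hno
  have hsub : X ⊆ (X ∩ L₁) ∪ (X ∩ L₂) := by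
    intro v hv
    rcases em (v ∈ L₁) with h | h
    · exact Finset.mem_union_left _ (Finset.mem_inter.2 ⟨hv, h⟩)
    · exact Finset.mem_union_right _ (Finset.mem_inter.2 ⟨hv, hno v hv h⟩)
  have := Finset.card_le_card hsub
  have := Finset.card_union_le (X ∩ L₁) (X ∩ L₂)
  have := h3 X hX L₁ hL₁ hX1
  have := h3 X hX L₂ hL₂ hX2
  omega

include h1 h2 h3 h4 hw4 in
/-- **A further line meets `L₁` in a point off `L₂`** when a second further line is present: by the covering
clause it lies in `L₁ ∪ L₂ ∪ Y` with at most one point on each, so exactly one on each; its point on `L₁` is not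
on `L₂` (else two points of `X` would lie on `Y`). -/
theorem meet_four_of_two_four {L₁ L₂ X Y : Finset β} (hL₁ : L₁ ∈ ls) (hL₂ : L₂ ∈ ls) (hX : X ∈ ls) (hY : Y ∈ ls)
    (h21 : L₂ ≠ L₁) (hX1 : X ≠ L₁) (hX2 : X ≠ L₂) (hY1 : Y ≠ L₁) (hY2 : Y ≠ L₂) (hYX : Y ≠ X)
    (c1 : L₁.card = 4) (c2 : L₂.card = 4) : ∃ x ∈ X, x ∈ L₁ ∧ x ∉ L₂ := by
  have cov := subset_of_two_four h1 h2 h3 h4 hw4 hL₁ hL₂ hY hX h21 hY1 hY2 hX1 hX2 hYX.symm c1 c2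
  obtain ⟨kX, _⟩ := shape_of_two_four h1 h2 h3 h4 hw4 hL₁ hL₂ hX h21 hX1 hX2 c1 c2
  have i1 := h3 X hX L₁ hL₁ hX1
  have i2 := h3 X hX L₂ hL₂ hX2
  have iY := h3 X hX Y hY hYX.symm
  by_contra hno
  push Not at hno
  -- every point of `X` on `L₁` is on `L₂`, so `X ⊆ (X ∩ L₂) ∪ (X ∩ Y)`, of size `≤ 2`
  have hsub : X ⊆ (X ∩ L₂) ∪ (X ∩ Y) := by
    intro v hv
    rcases cov v hv with h | h | h
    · exact Finset.mem_union_right _ (Finset.mem_inter.2 ⟨hv, h⟩)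
    · exact Finset.mem_union_left _ (Finset.mem_inter.2 ⟨hv, h⟩)
    · exact Finset.mem_union_left _ (Finset.mem_inter.2 ⟨hv, hno v hv h⟩)
  have := Finset.card_le_card hsub
  have := Finset.card_union_le (X ∩ L₂) (X ∩ Y)
  omega

include h1 h2 h3 h4 hw4 in
/-- **Distinct further lines have distinct points on `L₁`**: a common point on `L₁` together with the point of `X`
off `L₁ ∪ L₂` (which lies on `X'` by the covering clause) would be two common points. -/
theorem ne_of_mem_four {L₁ L₂ X X' : Finset β} (hL₁ : L₁ ∈ ls) (hL₂ : L₂ ∈ ls) (hX : X ∈ ls) (hX' : X' ∈ ls)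
    (h21 : L₂ ≠ L₁) (hX1 : X ≠ L₁) (hX2 : X ≠ L₂) (hX'1 : X' ≠ L₁) (hX'2 : X' ≠ L₂) (hne : X' ≠ X)
    (c1 : L₁.card = 4) (c2 : L₂.card = 4) {x : β} (hxX : x ∈ X) (hxX' : x ∈ X') (hx1 : x ∈ L₁) : False := by
  obtain ⟨kX, _⟩ := shape_of_two_four h1 h2 h3 h4 hw4 hL₁ hL₂ hX h21 hX1 hX2 c1 c2
  obtain ⟨t, htX, ht1, ht2⟩ := exists_off_two h3 hL₁ hL₂ hX hX1 hX2 kX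
  have cov := subset_of_two_four h1 h2 h3 h4 hw4 hL₁ hL₂ hX' hX h21 hX'1 hX'2 hX1 hX2 hne.symm c1 c2
  have htX' : t ∈ X' := by
    rcases cov t htX with h | h | h
    · exact h
    · exact absurd h ht2
    · exact absurd h ht1
  have hint := h3 X hX X' hX' hne.symm
  have htx : t ≠ x := fun h => ht1 (h ▸ hx1)
  exact htx (Finset.card_le_one.1 hint t (Finset.mem_inter.2 ⟨htX, htX'⟩) x (Finset.mem_inter.2 ⟨hxX, hxX'⟩))

include h1 h2 h3 h4 hw4 in
/-- **Two further lines force the 4-point lines to meet**: if `L₁ ∩ L₂ = ∅`, the ordering `X, L₁, Y, L₂` costs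
`1 + 2 + 1 + 2 = 6` (`Y` has its point on `L₂` off `L₁ ∪ X`; `L₂` meets `X ∪ L₁ ∪ Y` in `≤ 2` points). -/
theorem not_disjoint_of_two_four {L₁ L₂ X Y : Finset β} (hL₁ : L₁ ∈ ls) (hL₂ : L₂ ∈ ls) (hX : X ∈ ls) (hY : Y ∈ ls)
    (h21 : L₂ ≠ L₁) (hX1 : X ≠ L₁) (hX2 : X ≠ L₂) (hY1 : Y ≠ L₁) (hY2 : Y ≠ L₂) (hYX : Y ≠ X)
    (c1 : L₁.card = 4) (c2 : L₂.card = 4) (hdisj : L₁ ∩ L₂ = ∅) : False := by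
  have hw : ∀ L ∈ ls, ∀ v ∈ L, 1 ≤ w v := fun L hL v hv => by rcases h1 L hL v hv with h | h <;> omega
  have hc := h4 [L₂, Y, L₁, X] (by simp [h21, hY1, hYX, hY2.symm, hX2.symm, hX1.symm])
    (by simp [hL₁, hL₂, hX, hY])
  obtain ⟨a1, b1, c1', d1⟩ := cost_step w X [] (hw X hX)
  obtain ⟨a2, b2, c2', d2⟩ := cost_step w L₁ [X] (hw L₁ hL₁)
  obtain ⟨a3, b3, c3', d3⟩ := cost_step w Y [L₁, X] (hw Y hY)
  obtain ⟨a4, b4, c4', d4⟩ := cost_step w L₂ [Y, L₁, X] (hw L₂ hL₂)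
  obtain ⟨e0, e1, e2, e3⟩ := cost_start w X
  obtain ⟨kX, fX⟩ := shape_of_two_four h1 h2 h3 h4 hw4 hL₁ hL₂ hX h21 hX1 hX2 c1 c2
  obtain ⟨kY, fY⟩ := shape_of_two_four h1 h2 h3 h4 hw4 hL₁ hL₂ hY h21 hY1 hY2 c1 c2
  have wX := wsum_eq_card_add_fat w X (h1 X hX)
  -- `L₁` meets `X` in `≤ 1` point
  have i2 : (L₁ ∩ unionL [X]).card ≤ 1 := by
    simp only [unionL, Finset.union_empty]
    exact h3 L₁ hL₁ X hX hX1.symm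
  -- `Y` has a point off `L₁ ∪ X`: its point on `L₂`, which is not on `L₁` (disjoint) nor on `X` (that point of `X`
  -- would be on `L₂` and, with the point of `X ∩ Y` off `L₁ ∪ L₂`, give two common points of `X` and `Y`)
  obtain ⟨y₂, hyY, hy2, hy1⟩ := meet_four_of_two_four h1 h2 h3 h4 hw4 hL₂ hL₁ hY hX h21.symm hY2 hY1 hX2 hX1
    hYX.symm c2 c1
  have hyX : y₂ ∉ X := by
    intro hyX
    exact ne_of_mem_four h1 h2 h3 h4 hw4 hL₂ hL₁ hX hY h21.symm hX2 hX1 hY2 hY1 hYX c2 c1 hyX hyY hy2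
  have i3 : 1 ≤ (Y \ unionL [L₁, X]).card := by
    refine Finset.card_pos.2 ⟨y₂, Finset.mem_sdiff.2 ⟨hyY, ?_⟩⟩
    simp only [unionL, Finset.union_empty, Finset.mem_union, not_or]
    exact ⟨hy1, hyX⟩
  -- `L₂` meets `Y ∪ L₁ ∪ X` in `≤ 2` points
  have i4 : (L₂ ∩ unionL [Y, L₁, X]).card ≤ 2 := by
    simp only [unionL, Finset.union_empty]
    rw [Finset.inter_union_distrib_left, Finset.inter_union_distrib_left]
    refine (Finset.card_union_le _ _).trans ?_
    have hd : (L₂ ∩ L₁).card = 0 := by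
      rw [Finset.inter_comm, hdisj]; rfl
    have := Finset.card_union_le (L₂ ∩ L₁) (L₂ ∩ X)
    have := h3 L₂ hL₂ Y hY hY2.symm
    have := h3 L₂ hL₂ X hX hX2.symm
    omega
  omega

include h1 h2 h3 h4 hw4 in
/-- **At most three further lines** beside two 4-point lines: if two further lines exist, `L₁ ∩ L₂ ≠ ∅` and the
further lines inject into `L₁ ∖ L₂` (`≤ 3` points) by their point on `L₁`. -/
theorem card_le_five_of_two_four {L₁ L₂ : Finset β} (hL₁ : L₁ ∈ ls) (hL₂ : L₂ ∈ ls) (h21 : L₂ ≠ L₁)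
    (c1 : L₁.card = 4) (c2 : L₂.card = 4) : ls.card ≤ 5 := by
  set O := (ls.erase L₁).erase L₂ with hO
  have hOcard : O.card + 2 = ls.card := by
    rw [hO, Finset.card_erase_of_mem (Finset.mem_erase.2 ⟨h21, hL₂⟩), Finset.card_erase_of_mem hL₁]
    have := Finset.card_pos.2 ⟨L₁, hL₁⟩
    have : 2 ≤ ls.card := Finset.one_lt_card.2 ⟨L₁, hL₁, L₂, hL₂, h21.symm⟩
    omega
  have hOmem : ∀ X ∈ O, X ∈ ls ∧ X ≠ L₁ ∧ X ≠ L₂ := fun X hX => by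
    simp only [hO, Finset.mem_erase] at hX
    exact ⟨hX.2.2, hX.2.1, hX.1⟩
  by_cases hsmall : O.card ≤ 1
  · omega
  push Not at hsmall
  obtain ⟨X, hX, Y, hY, hXY⟩ := Finset.one_lt_card.1 hsmall
  obtain ⟨hXls, hX1, hX2⟩ := hOmem X hX
  obtain ⟨hYls, hY1, hY2⟩ := hOmem Y hY
  -- the 4-point lines meet
  have hmeet : L₁ ∩ L₂ ≠ ∅ := fun h =>
    not_disjoint_of_two_four h1 h2 h3 h4 hw4 hL₁ hL₂ hXls hYls h21 hX1 hX2 hY1 hY2 hXY.symm c1 c2 h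
  have hsd : (L₁ \ L₂).card ≤ 3 := by
    have := Finset.card_sdiff_add_card_inter L₁ L₂
    have : 0 < (L₁ ∩ L₂).card := Finset.card_pos.2 (Finset.nonempty_iff_ne_empty.2 hmeet)
    omega
  -- the injection `X ↦ X ∩ L₁` into the singletons of `L₁ ∖ L₂`
  have hinj : O.card ≤ ((L₁ \ L₂).image (fun x => ({x} : Finset β))).card := by
    refine Finset.card_le_card_of_injOn (fun X => X ∩ L₁) ?_ ?_
    · intro Z hZ
      obtain ⟨hZls, hZ1, hZ2⟩ := hOmem Z hZ
      -- a second further line to apply the covering clause with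
      obtain ⟨Z', hZ', hZ'Z⟩ : ∃ Z' ∈ O, Z' ≠ Z := by
        by_cases hZX : Z = X
        · exact ⟨Y, hY, fun h => hXY (hZX.symm.trans h.symm)⟩
        · exact ⟨X, hX, Ne.symm hZX⟩
      obtain ⟨hZ'ls, hZ'1, hZ'2⟩ := hOmem Z' hZ'
      obtain ⟨x, hxZ, hx1, hx2⟩ := meet_four_of_two_four h1 h2 h3 h4 hw4 hL₁ hL₂ hZls hZ'ls h21 hZ1 hZ2 hZ'1
        hZ'2 hZ'Z c1 c2
      refine Finset.mem_image.2 ⟨x, Finset.mem_sdiff.2 ⟨hx1, hx2⟩, ?_⟩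
      have hint := h3 Z hZls L₁ hL₁ hZ1
      symm
      exact Finset.eq_singleton_iff_unique_mem.2 ⟨Finset.mem_inter.2 ⟨hxZ, hx1⟩, fun y hy =>
        Finset.card_le_one.1 hint y hy x (Finset.mem_inter.2 ⟨hxZ, hx1⟩)⟩
    · intro Z hZ Z' hZ' heq
      obtain ⟨hZls, hZ1, hZ2⟩ := hOmem Z (Finset.mem_coe.1 hZ)
      obtain ⟨hZ'ls, hZ'1, hZ'2⟩ := hOmem Z' (Finset.mem_coe.1 hZ')
      by_contra hne
      -- a point of `Z` on `L₁`, which then lies on `Z'`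
      obtain ⟨x, hxZ, hx1, _⟩ := meet_four_of_two_four h1 h2 h3 h4 hw4 hL₁ hL₂ hZls hZ'ls h21 hZ1 hZ2 hZ'1
        hZ'2 (Ne.symm hne) c1 c2
      have hxZ' : x ∈ Z' := by
        have : x ∈ Z' ∩ L₁ := by
          simp only at heq
          rw [← heq]; exact Finset.mem_inter.2 ⟨hxZ, hx1⟩
        exact (Finset.mem_inter.1 this).1
      exact ne_of_mem_four h1 h2 h3 h4 hw4 hL₁ hL₂ hZls hZ'ls h21 hZ1 hZ2 hZ'1 hZ'2 (Ne.symm hne) c1 c2 hxZ hxZ'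
        hx1
  rw [Finset.card_image_of_injective _ Finset.singleton_injective] at hinj
  omega

include h1 h2 h3 h4 hw4 in
/-- **Two 4-point lines: cap sum `≤ 11`** — `4 + 4` for the 4-point lines, `1` for each of the `≤ 3` further
simple 3-point lines. -/
theorem sum_cap_le_eleven_of_two_four {L₁ L₂ : Finset β} (hL₁ : L₁ ∈ ls) (hL₂ : L₂ ∈ ls) (h21 : L₂ ≠ L₁)
    (c1 : L₁.card = 4) (c2 : L₂.card = 4) : ∑ L ∈ ls, capPaper L.card (fat w L) ≤ 11 := by
  have hm := card_le_five_of_two_four h1 h2 h3 h4 hw4 hL₁ hL₂ h21 c1 c2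
  have hL₂' : L₂ ∈ ls.erase L₁ := Finset.mem_erase.2 ⟨h21, hL₂⟩
  rw [← Finset.add_sum_erase ls _ hL₁, ← Finset.add_sum_erase (ls.erase L₁) _ hL₂']
  have hcap1 : capPaper L₁.card (fat w L₁) = 4 := by
    rw [c1, (simple_of_card_four (h1 L₁ hL₁) (hw4 L₁ hL₁) c1).1]; decide
  have hcap2 : capPaper L₂.card (fat w L₂) = 4 := by
    rw [c2, (simple_of_card_four (h1 L₂ hL₂) (hw4 L₂ hL₂) c2).1]; decide
  have hothers : ∀ X ∈ (ls.erase L₁).erase L₂, capPaper X.card (fat w X) = 1 := by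
    intro X hX
    simp only [Finset.mem_erase] at hX
    obtain ⟨kX, fX⟩ := shape_of_two_four h1 h2 h3 h4 hw4 hL₁ hL₂ hX.2.2 h21 hX.2.1 hX.1 c1 c2
    rw [kX, fX]; decide
  rw [Finset.sum_const_nat hothers, Finset.card_erase_of_mem hL₂', Finset.card_erase_of_mem hL₁, hcap1, hcap2]
  omega

end FiveFour

end FourCap

end S1

end PercRepro
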